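import Summits.BirchSwinnertonDyer.BirchSwinnertonDyer.Theorems.CyclotomicUntwistSigmaLineFamilyConvergence
import Summits.BirchSwinnertonDyer.BirchSwinnertonDyer.Theorems.CyclotomicUntwistSigmaLineFamilyValues
import Mathlib.Analysis.Normed.Group.Ultra
import HarnessLib

/-!
# Route `CyclotomicUntwist`, crux K1 `PSRankOneLowerHalfAtThree` (stmt-BirchSwinnertonDyer-21580):
# the σ-LINE FAMILY — BERNARDI'S SHARP RADIUS at `p ≥ 3`: `σ_c(z)` converges absolutely and
# `‖σ_c(z)‖ = ‖z‖` on the CLOSED disc `‖z‖ ≤ p⁻¹` (= all of `Ê(pℤ_p) = E₁(ℚ_p)`), for every `‖c‖ ≤ 1`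

Cell `pub/bsd-wall` (D-0145 line `route-BirchSwinnertonDyer-CyclotomicUntwist`), seat `bsd-line-cycu-p1`
g4, lane «σ-LINE FAMILY LAW», file 18. THEOREMS ONLY; helper `--supports` K1 = stmt-BirchSwinnertonDyer-21580.
BSD is not proved by this file and no crux is.

WHY. `CyclotomicUntwistSigmaLineFamilyConvergence` proved the CRUDE radius: `σ_c(p²t) ∈ p²t(1 + tℤ_p⟦t⟧)`,
i.e. convergence and `‖σ_c(z)‖ = ‖z‖` for `‖z‖ < p⁻²`; every downstream statement of the lane (height
laws, parallelogram, height datum, line data) therefore reads heights on the DEEP locus `‖z‖ ≤ p⁻³`,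
while the census's admissible locus (`CensusX42.IsTwistSigmaHeight`, PARI) is `v(z) ≥ 1`. Bernardi's
radius is `v(z) > 1/(p − 1)`; for `p ≥ 3` that is the closed disc `‖z‖ ≤ p⁻¹`. This file proves it for the
whole family from the exp-representation `σ_c = t·exp(Ψ)` (`…ExpRepresentation.exists_exp_representation`):

* §1 arithmetic: `2k + 1 ≤ p^k`, `4a ≤ p^a + 1`; **`two_mul_padicValNat_add_le`**: `2(v_p n + v_p j) + 1 ≤ n`
  for `0 < j < n` (`p ≥ 3`); `2·v_p(d!) ≤ d` (Legendre, Mathlib `sub_one_mul_padicValNat_factorial_lt_of_ne_zero`);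
* §2 weighted ultrametric coefficient bounds `‖[F]ₙ‖ ≤ A·ρⁿ` under products, powers and substitution into
  `exp` (`coeff_subst_eq_sum`, **`norm_coeff_exp_subst_le`**: `‖[Ψ]ₙ‖ ≤ √p^{n−1}` ⇒ `‖[exp∘Ψ]ₙ‖ ≤ √p^n`);
* §3 **`norm_coeff_psi_le`**: `‖Ψₙ‖ = ‖Gₙ/n‖ ≤ √p^{n−1}` (the integer lemma pays for BOTH denominators
  `n` and `i − 1`); **`norm_coeff_formalSigma_succ_le`**: `‖[t^{n+1}]σ_c‖ ≤ √p^n`;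
* §4 **`summable_norm_formalSigma_of_norm_le`**, **`norm_padicEval_formalSigma_of_norm_le`**
  (`‖σ_c(z)‖ = ‖z‖`), **`padicEval_formalSigma_ne_zero_of_norm_le`** for `‖z‖ ≤ p⁻¹`, `‖c‖ ≤ 1`, `3 ≤ p`.

Consequence for successors: the hypotheses `Summable ‖[tⁿ]σ·tⁿ‖`, `σ(t) ≠ 0` of the height difference law
(`…Values.sigmaHeight_formalSigma_sub`) now hold at every `t = p·s`, `‖s‖ < 1` — one level higher than
`…HeightLaw` — and the same weights applied to `exp(ε·log²)` reach `v(z) ≥ 1`.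
References: Bernardi 1981 §1; Mazur–Tate 1991 §3; Perrin-Riou 1984 §II. [cite: MazurTate1991, Thm. 3.1]
[cite: Robert2000PadicAnalysis, Ch. V §4.2 Proposition 1]
-/

set_option autoImplicit false
-- single-conjunct summit: `Summit.BirchSwinnertonDyer.BirchSwinnertonDyer.…` repeats the name by design
set_option linter.dupNamespace false

noncomputable section

open scoped Classical Nat

open PowerSeries WeierstrassCurve Literature.NumberTheory.EllipticCurves Literature.RingTheory.FormalGroups
  Literature.NumberTheory.LocalFields

namespace Summit.BirchSwinnertonDyer.BirchSwinnertonDyer.Theorems.PSSigmaLineFamilySharpRadius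

open Summit.BirchSwinnertonDyer.BirchSwinnertonDyer.Theorems.PSSigmaLineFamily
  Summit.BirchSwinnertonDyer.BirchSwinnertonDyer.Theorems.PSSigmaLineFamilyEvaluation
  Summit.BirchSwinnertonDyer.BirchSwinnertonDyer.Theorems.PSSigmaLineFamilyValues
  Summit.BirchSwinnertonDyer.BirchSwinnertonDyer.Theorems.PSSigmaLineFamilyExpRepresentation
  Summit.BirchSwinnertonDyer.BirchSwinnertonDyer.Theorems.PSSigmaLineFamilyConvergence

/-! ### §1 Arithmetic of `p`-adic valuations for `p ≥ 3` -/

section Arithmetic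

/-- `2k + 1 ≤ p^k` for `p ≥ 3`. [folklore] -/
theorem two_mul_add_one_le_pow {p : ℕ} (hp : 3 ≤ p) (k : ℕ) : 2 * k + 1 ≤ p ^ k := by
  induction k with
  | zero => simp
  | succ k ih =>
    have h3 : 3 * p ^ k ≤ p * p ^ k := Nat.mul_le_mul_right _ hp
    have hpk : 1 ≤ p ^ k := Nat.one_le_pow _ _ (by omega)
    calc 2 * (k + 1) + 1 = (2 * k + 1) + 2 := by ring
      _ ≤ p ^ k + 2 * p ^ k := by omega
      _ = 3 * p ^ k := by ring
      _ ≤ p * p ^ k := h3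
      _ = p ^ (k + 1) := by ring

/-- `4a ≤ p^a + 1` for `p ≥ 3`, `a ≥ 1`. [folklore] -/
theorem four_mul_le_pow_add_one {p : ℕ} (hp : 3 ≤ p) {a : ℕ} (ha : 1 ≤ a) : 4 * a ≤ p ^ a + 1 := by
  induction a, ha using Nat.le_induction with
  | base => rw [pow_one]; omega
  | succ a ha ih =>
    have hpa : p ≤ p ^ a := Nat.le_self_pow (by omega) p
    have h3 : 3 * p ^ a ≤ p * p ^ a := Nat.mul_le_mul_right _ hp
    have : p ^ (a + 1) = p * p ^ a := by ring
    omega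

/-- `2·v_p(n) + 1 ≤ n` for `n ≠ 0`, `p ≥ 3` (`p^{v_p n} ∣ n`). [folklore] -/
theorem two_mul_padicValNat_add_one_le {p : ℕ} [Fact p.Prime] (hp : 3 ≤ p) {n : ℕ} (hn : n ≠ 0) :
    2 * padicValNat p n + 1 ≤ n :=
  (two_mul_add_one_le_pow hp _).trans (Nat.le_of_dvd (Nat.pos_of_ne_zero hn) pow_padicValNat_dvd)

/-- **The integer lemma behind Bernardi's radius at `p ≥ 3`**: for `0 < j < n`,
`2·(v_p n + v_p j) + 1 ≤ n`. (If `v_p n ≤ v_p j` then `p^{v_p n} ∣ n − j`, so `n ≥ p^{v_p j} + p^{v_p n}`;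
else `n ≥ p^{v_p n} ≥ 4·v_p n − 1`.) [folklore] -/
theorem two_mul_padicValNat_add_le {p : ℕ} [Fact p.Prime] (hp : 3 ≤ p) {j n : ℕ} (hj : j ≠ 0)
    (hjn : j < n) : 2 * (padicValNat p n + padicValNat p j) + 1 ≤ n := by
  have hn : n ≠ 0 := by omega
  have hpa : p ^ padicValNat p n ∣ n := pow_padicValNat_dvd
  have hpb : p ^ padicValNat p j ∣ j := pow_padicValNat_dvd
  have ha1 := two_mul_add_one_le_pow hp (padicValNat p n)
  have hb1 := two_mul_add_one_le_pow hp (padicValNat p j)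
  rcases Nat.lt_or_ge (padicValNat p j) (padicValNat p n) with hab | hab
  · have h1 : p ^ padicValNat p n ≤ n := Nat.le_of_dvd (Nat.pos_of_ne_zero hn) hpa
    have h3 := four_mul_le_pow_add_one hp (show 1 ≤ padicValNat p n by omega)
    omega
  · have hpaj : p ^ padicValNat p n ∣ j := (pow_dvd_pow p hab).trans hpb
    have hsub : p ^ padicValNat p n ∣ n - j := Nat.dvd_sub hpa hpaj
    have h1 : p ^ padicValNat p n ≤ n - j := Nat.le_of_dvd (Nat.sub_pos_of_lt hjn) hsub
    have h2 : p ^ padicValNat p j ≤ j := Nat.le_of_dvd (Nat.pos_of_ne_zero hj) hpb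
    omega

/-- Legendre, crude form: `2·v_p(d!) ≤ d` for `p ≥ 3` (`(p−1)·v_p(d!) < d`). [folklore] -/
theorem two_mul_padicValNat_factorial_le {p : ℕ} [Fact p.Prime] (hp : 3 ≤ p) (d : ℕ) :
    2 * padicValNat p d ! ≤ d := by
  rcases eq_or_ne d 0 with rfl | hd
  · simp
  · have h := sub_one_mul_padicValNat_factorial_lt_of_ne_zero p hd
    have : 2 * padicValNat p d ! ≤ (p - 1) * padicValNat p d ! := Nat.mul_le_mul_right _ (by omega)
    omega

variable {p : ℕ} [Fact p.Prime]

/-- `‖(m : ℚ_p)⁻¹‖ = p^{v_p m}` for `m ≠ 0`. [folklore] -/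
theorem norm_inv_natCast {m : ℕ} (hm : m ≠ 0) : ‖((m : ℚ_[p]))⁻¹‖ = (p : ℝ) ^ padicValNat p m := by
  have hm' : (m : ℚ_[p]) ≠ 0 := Nat.cast_ne_zero.mpr hm
  rw [norm_inv, Padic.norm_eq_zpow_neg_valuation hm', Padic.valuation_natCast, zpow_neg, inv_inv,
    zpow_natCast]

/-- `1 ≤ √p`, `0 < √p` and `√p² = p` bookkeeping. [folklore] -/
theorem one_le_sqrt_prime : (1 : ℝ) ≤ √(p : ℝ) ∧ (0 : ℝ) < √(p : ℝ) ∧ √(p : ℝ) ^ 2 = p := by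
  have hp1 : (1 : ℝ) ≤ p := by exact_mod_cast (Fact.out : p.Prime).one_le
  exact ⟨Real.one_le_sqrt.mpr hp1, Real.sqrt_pos.mpr (by linarith), Real.sq_sqrt (by linarith)⟩

/-- `p^{v_p n} ≤ √p^{n−1}` for `n ≠ 0`, `p ≥ 3`. [folklore] -/
theorem pow_padicValNat_le_sqrt_pow (hp : 3 ≤ p) {n : ℕ} (hn : n ≠ 0) :
    (p : ℝ) ^ padicValNat p n ≤ √(p : ℝ) ^ (n - 1) := by
  obtain ⟨h1, -, h2⟩ := one_le_sqrt_prime (p := p)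
  rw [show (p : ℝ) ^ padicValNat p n = √(p : ℝ) ^ (2 * padicValNat p n) by rw [pow_mul, h2]]
  exact pow_le_pow_right₀ h1 (by have := two_mul_padicValNat_add_one_le hp hn; omega)

/-- `p^{v_p n}·p^{v_p j} ≤ √p^{n−1}` for `0 < j < n`, `p ≥ 3`. [folklore] -/
theorem pow_padicValNat_mul_le_sqrt_pow (hp : 3 ≤ p) {j n : ℕ} (hj : j ≠ 0) (hjn : j < n) :
    (p : ℝ) ^ padicValNat p n * (p : ℝ) ^ padicValNat p j ≤ √(p : ℝ) ^ (n - 1) := by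
  obtain ⟨h1, -, h2⟩ := one_le_sqrt_prime (p := p)
  rw [← pow_add, show (p : ℝ) ^ (padicValNat p n + padicValNat p j) =
    √(p : ℝ) ^ (2 * (padicValNat p n + padicValNat p j)) by rw [pow_mul, h2]]
  exact pow_le_pow_right₀ h1 (by have := two_mul_padicValNat_add_le hp hj hjn; omega)

end Arithmetic

/-! ### §2 Weighted ultrametric coefficient bounds -/

section Weighted

variable {p : ℕ} [Fact p.Prime]

/-- Products: `‖[F]ₙ‖ ≤ Aρⁿ`, `‖[G]ₙ‖ ≤ Bρⁿ` ⇒ `‖[FG]ₙ‖ ≤ ABρⁿ` (ultrametric). [folklore] -/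
theorem norm_coeff_mul_le_weighted {F G : ℚ_[p]⟦X⟧} {A B ρ : ℝ} (hA : 0 ≤ A) (hB : 0 ≤ B) (hρ : 0 ≤ ρ)
    (hF : ∀ n, ‖coeff n F‖ ≤ A * ρ ^ n) (hG : ∀ n, ‖coeff n G‖ ≤ B * ρ ^ n) (n : ℕ) :
    ‖coeff n (F * G)‖ ≤ A * B * ρ ^ n := by
  rw [coeff_mul]
  refine IsUltrametricDist.norm_sum_le_of_forall_le_of_nonneg (by positivity) fun kl hkl => ?_
  rw [Finset.HasAntidiagonal.mem_antidiagonal] at hkl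
  rw [norm_mul]
  calc ‖coeff kl.1 F‖ * ‖coeff kl.2 G‖ ≤ (A * ρ ^ kl.1) * (B * ρ ^ kl.2) :=
        mul_le_mul (hF _) (hG _) (norm_nonneg _) (by positivity)
    _ = A * B * ρ ^ n := by rw [← hkl, pow_add]; ring

/-- Powers: `‖[F]ₙ‖ ≤ Aρⁿ` ⇒ `‖[F^k]ₙ‖ ≤ A^k ρⁿ`. [folklore] -/
theorem norm_coeff_pow_le_weighted {F : ℚ_[p]⟦X⟧} {A ρ : ℝ} (hA : 0 ≤ A) (hρ : 0 ≤ ρ)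
    (hF : ∀ n, ‖coeff n F‖ ≤ A * ρ ^ n) (k n : ℕ) : ‖coeff n (F ^ k)‖ ≤ A ^ k * ρ ^ n := by
  induction k generalizing n with
  | zero =>
    rw [pow_zero, pow_zero, one_mul, coeff_one]
    split_ifs with h
    · rw [h, pow_zero, norm_one]
    · rw [norm_zero]; positivity
  | succ k ih =>
    rw [pow_succ, pow_succ]
    exact norm_coeff_mul_le_weighted (by positivity) hA hρ ih hF n

/-- `[tⁿ]F^k = 0` for `n < k` when `F(0) = 0`. [folklore] -/
theorem coeff_pow_eq_zero_of_lt {F : ℚ_[p]⟦X⟧} (hF : constantCoeff F = 0) {k n : ℕ} (h : n < k) :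
    coeff n (F ^ k) = 0 := by
  have hX : X ∣ F := by rwa [X_dvd_iff]
  exact (X_pow_dvd_iff.mp (pow_dvd_pow_of_dvd hX k)) n h

/-- `[tⁿ](f ∘ g) = Σ_{d ≤ n} f_d·[tⁿ]g^d` for `g(0) = 0`. [folklore] -/
theorem coeff_subst_eq_sum {g : ℚ_[p]⟦X⟧} (hg : constantCoeff g = 0) (f : ℚ_[p]⟦X⟧) (n : ℕ) :
    coeff n (f.subst g) = ∑ d ∈ Finset.range (n + 1), coeff d f * coeff n (g ^ d) := by
  rw [coeff_subst' (HasSubst.of_constantCoeff_zero' hg)]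
  simp_rw [smul_eq_mul]
  refine finsum_eq_sum_of_support_subset _ fun d hd => ?_
  simp only [Function.mem_support, ne_eq, Finset.coe_range, Set.mem_Iio] at hd ⊢
  by_contra h
  exact hd (by rw [coeff_pow_eq_zero_of_lt hg (by omega), mul_zero])

/-- **`exp ∘ Ψ` under the weight `√p`**: if `Ψ(0) = 0` and `‖Ψₙ‖ ≤ (√p)⁻¹·√pⁿ` (= `p^{(n−1)/2}`) then
`‖[exp ∘ Ψ]ₙ‖ ≤ √pⁿ` for `p ≥ 3` — the factorials cost `p^{v_p(d!)} ≤ √p^d`, exactly what the `d`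
factors `(√p)⁻¹` pay. [Bernardi 1981, §1] [folklore] -/
theorem norm_coeff_exp_subst_le (hp : 3 ≤ p) {Ψ : ℚ_[p]⟦X⟧} (hΨ0 : constantCoeff Ψ = 0)
    (hΨ : ∀ n, ‖coeff n Ψ‖ ≤ (√(p : ℝ))⁻¹ * √(p : ℝ) ^ n) (n : ℕ) :
    ‖coeff n ((exp ℚ_[p]).subst Ψ)‖ ≤ √(p : ℝ) ^ n := by
  obtain ⟨h1, hρ, h2⟩ := one_le_sqrt_prime (p := p)
  rw [coeff_subst_eq_sum hΨ0]
  refine IsUltrametricDist.norm_sum_le_of_forall_le_of_nonneg (by positivity) fun d _ => ?_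
  rw [norm_mul, coeff_exp]
  have hfac : ‖algebraMap ℚ ℚ_[p] (1 / (d ! : ℚ))‖ = (p : ℝ) ^ padicValNat p d ! := by
    rw [map_div₀, map_one, map_natCast, one_div, norm_inv_natCast (Nat.factorial_ne_zero d)]
  have hpow := norm_coeff_pow_le_weighted (inv_nonneg.mpr hρ.le) hρ.le hΨ d n
  have h3 : (p : ℝ) ^ padicValNat p d ! ≤ √(p : ℝ) ^ d := by
    rw [show (p : ℝ) ^ padicValNat p d ! = √(p : ℝ) ^ (2 * padicValNat p d !) by rw [pow_mul, h2]]
    exact pow_le_pow_right₀ h1 (two_mul_padicValNat_factorial_le hp d)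
  rw [hfac]
  calc (p : ℝ) ^ padicValNat p d ! * ‖coeff n (Ψ ^ d)‖
      ≤ √(p : ℝ) ^ d * ((√(p : ℝ))⁻¹ ^ d * √(p : ℝ) ^ n) := mul_le_mul h3 hpow (norm_nonneg _) (by positivity)
    _ = √(p : ℝ) ^ n := by rw [← mul_assoc, ← mul_pow, mul_inv_cancel₀ hρ.ne', one_pow, one_mul]

end Weighted

/-! ### §3 The coefficient bound `‖[t^{n+1}]σ_c‖ ≤ √pⁿ` -/

section Sigma

variable {p : ℕ} [Fact p.Prime] (V : WeierstrassCurve ℚ_[p]) [V.IsIntegral ℤ_[p]]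

/-- **`‖gₙ‖`** for `p ≥ 3`: `‖g₀‖ = ‖g₁‖·(≤) = 1` (`‖2‖_p = 1`), `‖gₙ‖ ≤ p^{v_p(n−1)}` (`n ≥ 2`). [folklore] -/
theorem norm_coeff_g_le_pow (hp : 3 ≤ p) {c : ℚ_[p]} (hc : ‖c‖ ≤ 1) {g : ℚ_[p]⟦X⟧}
    (hg0 : constantCoeff g = 1) (hg1 : coeff 1 g = -(V.a₁ / 2))
    (hgn : ∀ n : ℕ, 2 ≤ n → coeff n g =
      -(coeff n (V.formalOmega * (V.formalXMulSq + C c * X ^ 2))) / ((n : ℚ_[p]) - 1))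
    (n : ℕ) : ‖coeff n g‖ ≤ (p : ℝ) ^ padicValNat p (n - 1) := by
  rcases Nat.lt_or_ge n 2 with hlt | hge
  · interval_cases n
    · rw [coeff_zero_eq_constantCoeff_apply, hg0, norm_one]; simp
    · rw [hg1, norm_neg, norm_div]
      have ha : ‖V.a₁‖ ≤ 1 := V.norm_coeffs_le_one.1
      have h2 : ‖(2 : ℚ_[p])‖ = 1 := by
        have h := norm_inv_natCast (p := p) (m := 2) two_ne_zero
        rw [padicValNat.eq_zero_of_not_dvd (fun h => by have := Nat.le_of_dvd two_pos h; omega),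
          pow_zero, norm_inv, inv_eq_one] at h
        exact_mod_cast h
      rw [h2, div_one]; simpa using ha
  · rw [hgn n hge, norm_div, norm_neg]
    have hh : ‖coeff n (V.formalOmega * (V.formalXMulSq + C c * X ^ 2))‖ ≤ 1 :=
      isPadicInt_iff_coeff.mp (isPadicInt_rhs V hc) n
    have hcast : ((n : ℚ_[p]) - 1) = ((n - 1 : ℕ) : ℚ_[p]) := (Nat.cast_pred (by omega)).symm
    rw [div_eq_mul_inv, ← norm_inv, hcast, norm_inv_natCast (by omega)]
    calc _ ≤ 1 * (p : ℝ) ^ padicValNat p (n - 1) := by gcongr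
      _ = _ := one_mul _

/-- **`‖Ψₙ‖ ≤ √p^{n−1}`** (`p ≥ 3`, `‖c‖ ≤ 1`): `Ψₙ = Gₙ/n`, `Gₙ = Σ gᵢωⱼ`, and
`p^{v_p n}·p^{v_p(i−1)} ≤ √p^{n−1}` (`two_mul_padicValNat_add_le`). Stated in the weight form
`‖Ψₙ‖ ≤ (√p)⁻¹·√pⁿ`. [Bernardi 1981, §1] [folklore] -/
theorem norm_coeff_psi_le (hp : 3 ≤ p) {c : ℚ_[p]} (hc : ‖c‖ ≤ 1) {g Ψ : ℚ_[p]⟦X⟧}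
    (hg0 : constantCoeff g = 1) (hg1 : coeff 1 g = -(V.a₁ / 2))
    (hgn : ∀ n : ℕ, 2 ≤ n → coeff n g =
      -(coeff n (V.formalOmega * (V.formalXMulSq + C c * X ^ 2))) / ((n : ℚ_[p]) - 1))
    (hΨ0 : constantCoeff Ψ = 0) (hΨn : ∀ n : ℕ, 1 ≤ n → coeff n Ψ = coeff n (g * V.formalOmega) / (n : ℚ_[p]))
    (n : ℕ) : ‖coeff n Ψ‖ ≤ (√(p : ℝ))⁻¹ * √(p : ℝ) ^ n := by
  obtain ⟨h1, hρ, h2⟩ := one_le_sqrt_prime (p := p)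
  rcases Nat.eq_zero_or_pos n with rfl | hn
  · rw [coeff_zero_eq_constantCoeff_apply, hΨ0, norm_zero]; positivity
  have hgoal : (√(p : ℝ))⁻¹ * √(p : ℝ) ^ n = √(p : ℝ) ^ (n - 1) := by
    obtain ⟨m, rfl⟩ := Nat.exists_eq_add_of_le hn
    rw [show 1 + m - 1 = m by omega, add_comm, pow_succ, mul_comm, mul_assoc, mul_inv_cancel₀ hρ.ne', mul_one]
  rw [hgoal, hΨn n hn, norm_div, div_eq_mul_inv, ← norm_inv, norm_inv_natCast (by omega), coeff_mul, mul_comm]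
  -- `p^{v n} · ‖Σ gᵢ ωⱼ‖ ≤ √p^{n-1}`: bound each term by `√p^{n-1} / p^{v n}`
  have hpv : (0 : ℝ) < (p : ℝ) ^ padicValNat p n := by positivity
  rw [← le_div_iff₀' hpv]
  refine IsUltrametricDist.norm_sum_le_of_forall_le_of_nonneg (by positivity) fun kl hkl => ?_
  rw [Finset.HasAntidiagonal.mem_antidiagonal] at hkl
  rw [norm_mul, le_div_iff₀' hpv]
  have hω : ‖coeff kl.2 V.formalOmega‖ ≤ 1 := isPadicInt_iff_coeff.mp V.isPadicInt_formalOmega _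
  have hgi := norm_coeff_g_le_pow V hp hc hg0 hg1 hgn kl.1
  have hkey : (p : ℝ) ^ padicValNat p n * (p : ℝ) ^ padicValNat p (kl.1 - 1) ≤ √(p : ℝ) ^ (n - 1) := by
    rcases Nat.lt_or_ge kl.1 2 with hlt | hge
    · rw [show kl.1 - 1 = 0 by omega, padicValNat_zero_right, pow_zero, mul_one]
      exact pow_padicValNat_le_sqrt_pow hp (by omega)
    · exact pow_padicValNat_mul_le_sqrt_pow hp (by omega) (by omega)
  calc (p : ℝ) ^ padicValNat p n * (‖coeff kl.1 g‖ * ‖coeff kl.2 V.formalOmega‖)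
      ≤ (p : ℝ) ^ padicValNat p n * ((p : ℝ) ^ padicValNat p (kl.1 - 1) * 1) := by gcongr
    _ ≤ √(p : ℝ) ^ (n - 1) := by rw [mul_one]; exact hkey

/-- **BERNARDI COEFFICIENT BOUND**: `‖[t^{n+1}] formalSigma V c‖ ≤ √pⁿ` for a `p`-integral equation,
`‖c‖ ≤ 1`, `p ≥ 3` (from `σ_c = t·exp(Ψ)`, `norm_coeff_psi_le`, `norm_coeff_exp_subst_le`); and
`[t⁰]σ_c = 0`. [Bernardi 1981, §1] [cite: MazurTate1991, Thm. 3.1] -/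
theorem norm_coeff_formalSigma_succ_le (hp : 3 ≤ p) {c : ℚ_[p]} (hc : ‖c‖ ≤ 1) (n : ℕ) :
    ‖coeff (n + 1) (V.formalSigma c)‖ ≤ √(p : ℝ) ^ n ∧ coeff 0 (V.formalSigma c) = 0 := by
  obtain ⟨g, Ψ, hg0, hg1, hgn, hΨ0, hΨn, hrep⟩ := exists_exp_representation V c
  refine ⟨?_, ?_⟩
  · rw [hrep, coeff_succ_X_mul]
    exact norm_coeff_exp_subst_le hp hΨ0 (norm_coeff_psi_le V hp hc hg0 hg1 hgn hΨ0 hΨn) n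
  · rw [hrep, coeff_zero_eq_constantCoeff_apply, map_mul, constantCoeff_X, zero_mul]

end Sigma

/-! ### §4 Convergence and `‖σ_c(z)‖ = ‖z‖` on the closed disc `‖z‖ ≤ p⁻¹` -/

section Radius

variable {p : ℕ} [Fact p.Prime] (V : WeierstrassCurve ℚ_[p]) [V.IsIntegral ℤ_[p]]

/-- `p⁻¹ = ((√p)⁻¹)²` and `√p · p⁻¹ = (√p)⁻¹` bookkeeping. [folklore] -/
theorem sqrt_mul_inv_prime : √(p : ℝ) * (p : ℝ)⁻¹ = (√(p : ℝ))⁻¹ ∧ (√(p : ℝ))⁻¹ < 1 := by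
  obtain ⟨h1, hρ, h2⟩ := one_le_sqrt_prime (p := p)
  have hp1 : (1 : ℝ) < p := by exact_mod_cast (Fact.out : p.Prime).one_lt
  refine ⟨?_, inv_lt_one_of_one_lt₀ (by rw [← Real.sqrt_one]; exact Real.sqrt_lt_sqrt zero_le_one hp1)⟩
  have key : √(p : ℝ) * √(p : ℝ) = p := Real.mul_self_sqrt (by positivity)
  calc √(p : ℝ) * (p : ℝ)⁻¹ = √(p : ℝ) * (√(p : ℝ) * √(p : ℝ))⁻¹ := by rw [key]
    _ = (√(p : ℝ))⁻¹ := by rw [mul_inv, ← mul_assoc, mul_inv_cancel₀ hρ.ne', one_mul]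

/-- Inner term bound: `‖[t^{n+1}]σ_c · zⁿ‖ ≤ ((√p)⁻¹)ⁿ` for `‖z‖ ≤ p⁻¹`. [folklore] -/
theorem norm_coeff_succ_mul_pow_le (hp : 3 ≤ p) {c : ℚ_[p]} (hc : ‖c‖ ≤ 1) {z : ℚ_[p]}
    (hz : ‖z‖ ≤ (p : ℝ)⁻¹) (n : ℕ) :
    ‖coeff (n + 1) (V.formalSigma c) * z ^ n‖ ≤ ((√(p : ℝ))⁻¹) ^ n := by
  obtain ⟨hmul, -⟩ := sqrt_mul_inv_prime (p := p)
  rw [norm_mul, norm_pow, ← hmul, mul_pow]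
  gcongr
  exact (norm_coeff_formalSigma_succ_le V hp hc n).1

/-- Term bound: `‖[t^{n+1}]σ_c · z^{n+1}‖ ≤ ((√p)⁻¹)ⁿ · p⁻¹` for `‖z‖ ≤ p⁻¹`. [folklore] -/
theorem norm_term_formalSigma_succ_le (hp : 3 ≤ p) {c : ℚ_[p]} (hc : ‖c‖ ≤ 1) {z : ℚ_[p]}
    (hz : ‖z‖ ≤ (p : ℝ)⁻¹) (n : ℕ) :
    ‖coeff (n + 1) (V.formalSigma c) * z ^ (n + 1)‖ ≤ ((√(p : ℝ))⁻¹) ^ n * (p : ℝ)⁻¹ := by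
  rw [pow_succ, ← mul_assoc, norm_mul]
  exact mul_le_mul (norm_coeff_succ_mul_pow_le V hp hc hz n) hz (norm_nonneg _) (by positivity)

/-- **BERNARDI'S RADIUS (p ≥ 3)**: `Σ [tⁿ]σ_c · zⁿ` converges absolutely for `‖z‖ ≤ p⁻¹`, `‖c‖ ≤ 1`.
[Bernardi 1981, §1] [cite: MazurTate1991, Thm. 3.1] -/
theorem summable_norm_formalSigma_of_norm_le (hp : 3 ≤ p) {c : ℚ_[p]} (hc : ‖c‖ ≤ 1) {z : ℚ_[p]}
    (hz : ‖z‖ ≤ (p : ℝ)⁻¹) : Summable fun n : ℕ => ‖coeff n (V.formalSigma c) * z ^ n‖ := by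
  obtain ⟨-, hρ, -⟩ := one_le_sqrt_prime (p := p)
  obtain ⟨-, hlt⟩ := sqrt_mul_inv_prime (p := p)
  rw [← summable_nat_add_iff 1]
  exact Summable.of_nonneg_of_le (fun n => norm_nonneg _) (fun n => norm_term_formalSigma_succ_le V hp hc hz n)
    ((summable_geometric_of_lt_one (inv_nonneg.mpr hρ.le) hlt).mul_right _)

/-- The inner series `Σ [t^{n+1}]σ_c · zⁿ` is summable for `‖z‖ ≤ p⁻¹`. [folklore] -/
theorem summable_coeff_succ_mul_pow (hp : 3 ≤ p) {c : ℚ_[p]} (hc : ‖c‖ ≤ 1) {z : ℚ_[p]}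
    (hz : ‖z‖ ≤ (p : ℝ)⁻¹) : Summable fun n : ℕ => coeff (n + 1) (V.formalSigma c) * z ^ n := by
  obtain ⟨-, hρ, -⟩ := one_le_sqrt_prime (p := p)
  obtain ⟨-, hlt⟩ := sqrt_mul_inv_prime (p := p)
  exact Summable.of_norm_bounded (summable_geometric_of_lt_one (inv_nonneg.mpr hρ.le) hlt)
    (fun n => norm_coeff_succ_mul_pow_le V hp hc hz n)

/-- **`σ_c(z) = z · (1 + η)` with `‖η‖ ≤ (√p)⁻¹`** on `‖z‖ ≤ p⁻¹` (`‖c‖ ≤ 1`, `p ≥ 3`). [Bernardi 1981, §1]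
[cite: Robert2000PadicAnalysis, Ch. V §4.2 Proposition 1] -/
theorem padicEval_formalSigma_eq_mul (hp : 3 ≤ p) {c : ℚ_[p]} (hc : ‖c‖ ≤ 1) {z : ℚ_[p]}
    (hz : ‖z‖ ≤ (p : ℝ)⁻¹) :
    padicEval (V.formalSigma c) z =
        z * (1 + ∑' n : ℕ, coeff (n + 2) (V.formalSigma c) * z ^ (n + 1)) ∧
      ‖∑' n : ℕ, coeff (n + 2) (V.formalSigma c) * z ^ (n + 1)‖ ≤ (√(p : ℝ))⁻¹ := by
  obtain ⟨h1, hρ, -⟩ := one_le_sqrt_prime (p := p)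
  have hsum' : Summable fun n : ℕ => coeff n (V.formalSigma c) * z ^ n :=
    (summable_norm_formalSigma_of_norm_le V hp hc hz).of_norm
  have h0 : coeff 0 (V.formalSigma c) = 0 := (norm_coeff_formalSigma_succ_le V hp hc 0).2
  have hinner := summable_coeff_succ_mul_pow V hp hc hz
  refine ⟨?_, ?_⟩
  · have hL : ∑' b : ℕ, coeff (b + 1) (V.formalSigma c) * z ^ (b + 1) =
        z * ∑' b : ℕ, coeff (b + 1) (V.formalSigma c) * z ^ b := by
      rw [← tsum_mul_left]; exact tsum_congr fun b => by ring
    rw [padicEval, hsum'.tsum_eq_zero_add, h0, zero_mul, zero_add, hL, hinner.tsum_eq_zero_add,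
      coeff_one_formalSigma V c, pow_zero, mul_one]
  · refine IsUltrametricDist.norm_tsum_le_of_forall_le_of_nonneg (by positivity) fun n => ?_
    calc ‖coeff (n + 2) (V.formalSigma c) * z ^ (n + 1)‖ ≤ ((√(p : ℝ))⁻¹) ^ (n + 1) :=
          norm_coeff_succ_mul_pow_le V hp hc hz (n + 1)
      _ ≤ (√(p : ℝ))⁻¹ := by
          rw [pow_succ]
          exact mul_le_of_le_one_left (inv_nonneg.mpr hρ.le) (pow_le_one₀ (inv_nonneg.mpr hρ.le)
            (inv_le_one_of_one_le₀ h1))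

/-- **`‖σ_c(z)‖ = ‖z‖` on the closed disc `‖z‖ ≤ p⁻¹`** (`‖c‖ ≤ 1`, `p ≥ 3`). [Bernardi 1981, §1]
[cite: Robert2000PadicAnalysis, Ch. V §4.2 Proposition 1] -/
theorem norm_padicEval_formalSigma_of_norm_le (hp : 3 ≤ p) {c : ℚ_[p]} (hc : ‖c‖ ≤ 1) {z : ℚ_[p]}
    (hz : ‖z‖ ≤ (p : ℝ)⁻¹) : ‖padicEval (V.formalSigma c) z‖ = ‖z‖ := by
  obtain ⟨heq, hη⟩ := padicEval_formalSigma_eq_mul V hp hc hz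
  obtain ⟨-, hlt⟩ := sqrt_mul_inv_prime (p := p)
  have hη1 : ‖∑' n : ℕ, coeff (n + 2) (V.formalSigma c) * z ^ (n + 1)‖ < ‖(1 : ℚ_[p])‖ := by
    rw [norm_one]; exact hη.trans_lt hlt
  rw [heq, norm_mul, IsUltrametricDist.norm_add_eq_max_of_norm_ne_norm (ne_of_gt hη1),
    max_eq_left hη1.le, norm_one, mul_one]

/-- `σ_c(z) ≠ 0` for `0 < ‖z‖ ≤ p⁻¹` (`‖c‖ ≤ 1`, `p ≥ 3`). [Bernardi 1981, §1]
[cite: Robert2000PadicAnalysis, Ch. V §4.2 Proposition 1] -/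
theorem padicEval_formalSigma_ne_zero_of_norm_le (hp : 3 ≤ p) {c : ℚ_[p]} (hc : ‖c‖ ≤ 1) {z : ℚ_[p]}
    (hz : ‖z‖ ≤ (p : ℝ)⁻¹) (hz0 : z ≠ 0) : padicEval (V.formalSigma c) z ≠ 0 := by
  rw [← norm_pos_iff, norm_padicEval_formalSigma_of_norm_le V hp hc hz, norm_pos_iff]
  exact hz0

end Radius

end Summit.BirchSwinnertonDyer.BirchSwinnertonDyer.Theorems.PSSigmaLineFamilySharpRadius

end
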